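import Summits.AnomalousDissipation.AnomalousDissipation.Theorems.BaireTransferRobustLoudUpgradeStubSteadyPersist
import Literature.Analysis.FluidPDE.SteadyNSLatticeLinearised
import Literature.Analysis.Calculus.BorderedImplicitFunction

/-!
# Stub `stub_malkinBordered` of the line `malkin-cone-group-orbits` (crux stmt-AnomalousDissipation-1144),
# part A: the BORDERED steady implicit function theorem at a Malkin-visible Goldstone steady state

Registered stub (proved in `BaireTransferRobustLoudUpgradeStubMalkinBordered.lean`, which imports this file):
`theorem stub_malkinBordered : ∀ (S : Finset (Fin 3 → ℤ)) (a E ε : ℝ), malkinSteady S a E ε ⊆ borderedSteady S a E ε`;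
this part file proves the registered sub-goal `malkinBordered_partA` (= `exists_bordered_correction` in Pi-form).

Given `c ∈ malkinSteady`: a mean-zero classical steady state `u₀` of `NS_ν(f_c)` with STRICT budgets, a
lattice direction `dir` with `c` `dir`-invariant, kernel of the classical linearisation in the mean-zero
class inside `ℂ·∂_dir u₀` and ONE `dir`-breaking `d ∈ P_S` with `f_d ∉ range L(ν,u₀)`.  On the Fourier
lattice (the state space `W ⊂ ℓ²(ℤ³; ℂ³)`, the steady map `G(x) = 4π²ν x + B(x,x)` and the force map
`Fm` of `Literature/Analysis/FluidPDE/SteadyNSLatticePersistence.lean`, exactly as in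
`Theorems/BaireTransferRobustLoudUpgradeStubSteadyPersist.lean`) the derivative `T = DG(x₀) = 4π²ν·1 + K`
is a compact perturbation of the isomorphism `4π²ν·1`; its kernel vectors are (lattice regularity +
synthesis, `SteadyLattice.exists_linNSResolventRel_of_latticeEq`) classical kernel fields, hence complex —
and by conjugate symmetry REAL (`eq_re_smul_of_isConjSymm`) — multiples of the Goldstone vector
`g = 𝓕(∂_dir u₀) ∈ W` (`exists_dirDerivVec`); a lattice solution of `T x = −Fm d` would be a classical
solution of `L(ν,u₀) w = f_d`, excluded by visibility.  The abstract Malkin implicit function theorem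
`Literature.Analysis.Calculus.malkin_implicit` (bordering lemma + IFT, landed separately) then yields
`σ`, `ℓ = Dσ(c)` with `σ c = 0`, `ℓ d = 1`, and states `υ c'` solving `G(υ c') = Fm(c' − σ(c') d)`,
continuous at `c`; these are classical steady states of the corrected forces (`exists_steadyState_of_latticeEq`),
`H¹`-close to `u₀` (`h1_le_of_coeff`); the budgets then persist inside the strict slack (the Peter–Paul
window of `…StubSteadyWindow.lean`, carried out in the importing file).  Pure proof file (no definitions).

References: Vanderbauwhede 1982 Ch. 8 (Thm. 8.2.11, §8.5); Dancer 1984; Chow–Hale 1982 §2.4; Temam 1979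
Ch. II §1.
-/

-- `Summit.<Summit>.<Problem>` is the tree's mandated summit-side namespace (CONVENTIONS §2); for this
-- single-conjunct summit the two coincide, so the duplicate is deliberate.
set_option linter.dupNamespace false

noncomputable section

open scoped BigOperators Topology ENNReal NNReal InnerProductSpace ComplexConjugate
open Filter Set Function TopologicalSpace MeasureTheory UnitAddTorus

namespace Summit.AnomalousDissipation.AnomalousDissipation.Theorems.RobustLoudUpgrade.MalkinBordered

open Literature.Analysis.FunctionSpaces Literature.Analysis.FunctionSpaces.Torus
open Literature.Analysis.FunctionSpaces.EuclideanSpace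
open Literature.Analysis.FluidPDE
open Literature.Analysis.FluidPDE.ScalarFourier
open Literature.Analysis.FluidPDE.SteadyLattice
open Literature.Analysis.Calculus
open Summit.AnomalousDissipation.AnomalousDissipation.Theses.BaireTransfer
open Summit.AnomalousDissipation.AnomalousDissipation.Theorems.RobustLoudUpgrade.SteadyPersist

/-! ## §1 The bordered steady implicit function theorem on the lattice -/

section Bordered

variable {S : Finset (Fin 3 → ℤ)}

set_option maxHeartbeats 800000 in
/-- **The bordered steady implicit function theorem at a Malkin-visible Goldstone steady state**
(Vanderbauwhede 1982 Thm. 8.2.11 / §8.5; Dancer 1984), classical formulation: if the mean-zero classical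
steady state `u₀` of `NS_ν(f_c)` has classical mean-zero kernel of its linearisation inside `ℂ·∂_dir u₀` and
`f_d ∉ range L(ν,u₀)`, then there are `σ : P_S → ℝ`, `ℓ = Dσ(c)` with `σ c = 0`, `ℓ d = 1`, such that for
every `δ > 0`, on a ball around `c`, `σ` is continuous and every corrected force `f_{c' − σ(c') d}` carries a
mean-zero classical steady state within squared `H¹`-distance `δ` of `u₀`. [folklore] -/
theorem exists_bordered_correction {c d : Coeff S} {ν : ℝ} (hν : 0 < ν) {u₀ : (UnitAddTorus (Fin 3)) → (EuclideanSpace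
    ℝ (Fin 3))} {p₀ : (UnitAddTorus (Fin 3)) → ℝ}
    (hst : Torus.IsSteadyNSState ν (force S c) u₀ p₀) (h0 : HasZeroMean u₀) {dir : Fin 3 → ℤ}
    (hker : ∀ w, Torus.LinNSResolventRel ν u₀ 0 w 0 → ∃ z : ℂ, w = z • goldstone dir u₀)
    (hvis : ∀ w, ¬ Torus.LinNSResolventRel ν u₀ 0 w (cplx (force S d))) :
    ∃ (σ : Coeff S → ℝ) (ℓ : Coeff S →L[ℝ] ℝ), σ c = 0 ∧ HasFDerivAt σ ℓ c ∧ ℓ d = 1 ∧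
      ∀ δ : ℝ, 0 < δ → ∃ r : ℝ, 0 < r ∧ ContinuousOn σ (Metric.ball c r) ∧
        ∀ c' ∈ Metric.ball c r, ∃ (u' : (UnitAddTorus (Fin 3)) → (EuclideanSpace ℝ (Fin 3))) (p' : (UnitAddTorus (Fin
            3)) → ℝ),
          Torus.IsSteadyNSState ν (force S (c' - σ c' • d)) u' p' ∧ HasZeroMean u' ∧ h1DistSq u' u₀ < δ := by
  -- §1 the unperturbed state on the Fourier side (pattern of `steadyPersistsAt_of_nondeg`)
  have hu₀ : IsSmooth u₀ := hst.smooth_velocity.isSmooth_slice (Set.mem_univ 0)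
  have hdiv₀ : IsDivFree u₀ := hst.divFree 0 (Set.mem_univ 0)
  set a : (Fin 3 → ℤ) → (EuclideanSpace ℂ (Fin 3)) := mFourierCoeff (complexify ∘ u₀) with ha
  have har : RapidDecay a := hu₀.complexify_comp.rapidDecay_mFourierCoeff
  have hat : ∀ m : (Fin 3 → ℤ), (∑ jj : Fin 3, ((m jj : ℤ) : ℂ) * (a m) jj) = 0 :=
      fun m => hdiv₀.sum_mul_mFourierCoeff_eq_zero hu₀ m
  have ha0 : a 0 = 0 := mFourierCoeff_complexify_zero_of_hasZeroMean hu₀ h0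
  have hacs : IsConjSymm a := isConjSymm_mFourierCoeff hu₀.integrable
  have heq₀ : ∀ k : (Fin 3 → ℤ), (((ν * (4 * Real.pi ^ 2 * freqNormSq k)) : ℝ) : ℂ) • a k + Torus.lerayCoeff k
      ((WithLp.toLp 2 (fun pp : Fin 3 => transportSym (fun jj mm => a mm jj) (fun mm => a mm pp) k) : EuclideanSpace ℂ
      (Fin 3))) =
      mFourierCoeff (complexify ∘ force S c) k := fun k => by
    rw [ha, fourier_eq_of_isSteadyNSState hst (isSmooth_force' c) h0 k, lerayCoeff_forceCoeff]
  -- §2 the state space, the bilinear map, the force map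
  obtain ⟨W, hW, hWc⟩ := exists_space
  haveI : CompleteSpace W := completeSpace_W hWc
  obtain ⟨B, hB, hBb⟩ := exists_bilinear hW
  obtain ⟨Fm, hFm⟩ := exists_forceMap (S := S) hW
  -- §3 the base point `x₀`
  set X₀ : (Fin 3 → ℤ) → (EuclideanSpace ℂ (Fin 3)) := fun k => ((freqNormSq k : ℝ) : ℂ) • a k with hX₀
  have hX₀r : RapidDecay X₀ := by
    refine har.of_norm_le_mul_pow (C := 1) (s := 1) fun k => ?_
    rw [hX₀]
    dsimp only
    rw [norm_smul, Complex.norm_real, Real.norm_of_nonneg (freqNormSq_nonneg k), one_mul, pow_one]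
    exact mul_le_mul_of_nonneg_right (by linarith [freqNormSq_nonneg k]) (norm_nonneg _)
  have hX₀V : ((X₀ : (Fin 3 → ℤ) → EuclideanSpace ℂ (Fin 3)) 0 = 0 ∧ (∀ kk : Fin 3 → ℤ, (∑ jj : Fin 3, ((kk jj : ℤ) :
      ℂ) * ((X₀ : (Fin 3 → ℤ) → EuclideanSpace ℂ (Fin 3)) kk) jj) = 0) ∧ IsConjSymm (X₀ : (Fin 3 → ℤ) → EuclideanSpace
      ℂ (Fin 3))) := by
    refine ⟨by simp [hX₀, freqNormSq_zero], fun k => by rw [hX₀]; dsimp only; rw [kdot_smul, hat k, mul_zero],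
      fun k => ?_⟩
    rw [hX₀]
    dsimp only
    rw [freqNormSq_neg, hacs k, conjVec_smul, Complex.conj_ofReal]
  set x₀ : W := ⟨⟨X₀, memℓp_two_of_rapidDecay hX₀r⟩, (hW _).2 hX₀V⟩ with hx₀def
  have hx₀ : ((x₀ : (lp (fun _ : Fin 3 → ℤ => EuclideanSpace ℂ (Fin 3)) 2)) : (Fin 3 → ℤ) → (EuclideanSpace ℂ (Fin
      3))) = X₀ := rfl
  have hcf : ((fun mm : Fin 3 → ℤ => (((freqNormSq mm)⁻¹ : ℝ) : ℂ)) • (((x₀ : (lp (fun _ : Fin 3 → ℤ => EuclideanSpace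
      ℂ (Fin 3)) 2)) : (Fin 3 → ℤ) → (EuclideanSpace ℂ (Fin 3))) : (Fin 3 → ℤ) → EuclideanSpace ℂ (Fin 3))) =
      a := by rw [hx₀, hX₀]; exact cf_weight_smul ha0
  -- §4 the steady map and its derivative
  set cν : ℝ := 4 * Real.pi ^ 2 * ν with hcν
  have hcν0 : cν ≠ 0 := by positivity
  set G : W → W := fun x => cν • x + B x x with hG
  set K : W →L[ℝ] W := (hBb.deriv (x₀, x₀)).comp ((ContinuousLinearMap.id ℝ W).prod (ContinuousLinearMap.id ℝ W))
    with hK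
  have hKw : ∀ w, K w = B x₀ w + B w x₀ := fun w => by simp [hK, IsBoundedBilinearMap.deriv_apply]
  have hGd : HasStrictFDerivAt G (cν • ContinuousLinearMap.id ℝ W + K) x₀ := hasStrictFDerivAt_steadyMap hBb cν x₀
  have hKc : IsCompactOperator K := isCompactOperator_linearised hWc hB x₀ (by rw [hcf]; exact har) K hKw
  have hGcd : ContDiffAt ℝ 1 G x₀ := by
    have h1 : ContDiff ℝ 1 (fun x : W => cν • x) := contDiff_id.const_smul cν
    have h2 : ContDiff ℝ 1 (fun x : W => B x x) :=
      (hBb.contDiff (n := 1)).comp (contDiff_id.prodMk contDiff_id)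
    exact (h1.add h2).contDiffAt
  -- coordinates of `G`
  have hGcoe : ∀ x : W, (((G x : W) : (lp (fun _ : Fin 3 → ℤ => EuclideanSpace ℂ (Fin 3)) 2)) : (Fin 3 → ℤ) →
      (EuclideanSpace ℂ (Fin 3))) = fun k => ((cν : ℝ) : ℂ) • ((x : (lp (fun _ : Fin 3 → ℤ => EuclideanSpace ℂ (Fin
      3)) 2)) : (Fin 3 → ℤ) → (EuclideanSpace ℂ (Fin 3))) k +
      Torus.lerayCoeff k ((WithLp.toLp 2 (fun pp : Fin 3 => transportSym (fun jj mm => (((fun mm : Fin 3 →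
          ℤ => (((freqNormSq mm)⁻¹ : ℝ) : ℂ)) • (((x : (lp (fun _ : Fin 3 → ℤ => EuclideanSpace ℂ (Fin 3)) 2)) : (Fin
          3 → ℤ) → (EuclideanSpace ℂ (Fin 3))) : (Fin 3 → ℤ) → EuclideanSpace ℂ (Fin 3)))) mm jj) (fun mm => (((fun
          mm : Fin 3 → ℤ => (((freqNormSq mm)⁻¹ : ℝ) : ℂ)) • (((x : (lp (fun _ : Fin 3 → ℤ => EuclideanSpace ℂ (Fin
          3)) 2)) : (Fin 3 → ℤ) → (EuclideanSpace ℂ (Fin 3))) : (Fin 3 → ℤ) → EuclideanSpace ℂ (Fin 3)))) mm pp) k) :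
          EuclideanSpace ℂ (Fin 3))) := by
    intro x
    rw [hG]
    dsimp only
    rw [coeW_add, coeW_smul, hB]
    funext k
    simp only [Pi.add_apply, Pi.smul_apply, Complex.coe_smul]
  -- coordinates of the linearisation `T = cν·1 + K`
  set T : W →L[ℝ] W := cν • ContinuousLinearMap.id ℝ W + K with hT
  have hTw : ∀ w : W, T w = cν • w + K w := fun w => by simp [hT]
  have hTcoe : ∀ (w : W) (k : (Fin 3 → ℤ)), (((T w : W) : (lp (fun _ : Fin 3 → ℤ => EuclideanSpace ℂ (Fin 3)) 2)) :
      (Fin 3 → ℤ) → (EuclideanSpace ℂ (Fin 3))) k =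
      (((4 * Real.pi ^ 2 * ν : ℝ)) : ℂ) • ((w : (lp (fun _ : Fin 3 → ℤ => EuclideanSpace ℂ (Fin 3)) 2)) : (Fin 3 → ℤ)
          → (EuclideanSpace ℂ (Fin 3))) k +
        Torus.lerayCoeff k ((WithLp.toLp 2 (fun pp : Fin 3 => transportSym (fun jj mm => a mm jj) (fun mm => (((fun
            mm : Fin 3 → ℤ => (((freqNormSq mm)⁻¹ : ℝ) : ℂ)) • (((w : (lp (fun _ : Fin 3 → ℤ => EuclideanSpace ℂ (Fin
            3)) 2)) : (Fin 3 → ℤ) → (EuclideanSpace ℂ (Fin 3))) : (Fin 3 → ℤ) → EuclideanSpace ℂ (Fin 3)))) mm pp)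
            k) : EuclideanSpace ℂ (Fin 3)) + (WithLp.toLp 2 (fun pp : Fin 3 => transportSym (fun jj mm => (((fun mm :
            Fin 3 → ℤ => (((freqNormSq mm)⁻¹ : ℝ) : ℂ)) • (((w : (lp (fun _ : Fin 3 → ℤ => EuclideanSpace ℂ (Fin 3))
            2)) : (Fin 3 → ℤ) → (EuclideanSpace ℂ (Fin 3))) : (Fin 3 → ℤ) → EuclideanSpace ℂ (Fin 3)))) mm jj) (fun
            mm => a mm pp) k) : EuclideanSpace ℂ (Fin 3))) := by
    intro w k
    rw [hTw, coeW_add, hKw, coeW_add, coeW_smul, hB, hB, hcf]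
    simp only [Pi.add_apply, Pi.smul_apply]
    rw [← lerayCoeff_add', ← Complex.coe_smul]
  -- §5 the Goldstone vector `g ∈ W`
  obtain ⟨g, hg⟩ := exists_dirDerivVec hW hu₀ hdiv₀ dir
  set v : (UnitAddTorus (Fin 3)) → (EuclideanSpace ℝ (Fin 3)) := fun y => ∑ i, (dir i : ℝ) • Torus.partialDeriv i u₀
      y with hv
  have hgold : goldstone dir u₀ = complexify ∘ v := by
    funext y
    simp only [goldstone, Function.comp_apply, hv, realToComplex_eq_complexify]
  have hvs : IsSmooth v := isSmooth_dirDeriv hu₀ dir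
  have hVcs : IsConjSymm (mFourierCoeff (complexify ∘ v)) := isConjSymm_mFourierCoeff hvs.integrable
  -- §6 kernel transfer: `T x = 0 ⇒ x ∈ ℝ·g`
  have hkerT : ∀ x : W, T x = 0 → ∃ z : ℝ, x = z • g := by
    intro x hx
    have hco : ∀ k : (Fin 3 → ℤ), (((4 * Real.pi ^ 2 * ν : ℝ)) : ℂ) • ((x : (lp (fun _ : Fin 3 → ℤ => EuclideanSpace ℂ
        (Fin 3)) 2)) : (Fin 3 → ℤ) → (EuclideanSpace ℂ (Fin 3))) k +
        Torus.lerayCoeff k ((WithLp.toLp 2 (fun pp : Fin 3 => transportSym (fun jj mm => a mm jj) (fun mm => (((fun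
            mm : Fin 3 → ℤ => (((freqNormSq mm)⁻¹ : ℝ) : ℂ)) • (((x : (lp (fun _ : Fin 3 → ℤ => EuclideanSpace ℂ (Fin
            3)) 2)) : (Fin 3 → ℤ) → (EuclideanSpace ℂ (Fin 3))) : (Fin 3 → ℤ) → EuclideanSpace ℂ (Fin 3)))) mm pp)
            k) : EuclideanSpace ℂ (Fin 3)) + (WithLp.toLp 2 (fun pp : Fin 3 => transportSym (fun jj mm => (((fun mm :
            Fin 3 → ℤ => (((freqNormSq mm)⁻¹ : ℝ) : ℂ)) • (((x : (lp (fun _ : Fin 3 → ℤ => EuclideanSpace ℂ (Fin 3))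
            2)) : (Fin 3 → ℤ) → (EuclideanSpace ℂ (Fin 3))) : (Fin 3 → ℤ) → EuclideanSpace ℂ (Fin 3)))) mm jj) (fun
            mm => a mm pp) k) : EuclideanSpace ℂ (Fin 3))) =
        -Torus.lerayCoeff k (mFourierCoeff (0 : (UnitAddTorus (Fin 3)) → (EuclideanSpace ℂ (Fin 3))) k) := by
      intro k
      have h := congrArg (fun z : W => (((z : W) : (lp (fun _ : Fin 3 → ℤ => EuclideanSpace ℂ (Fin 3)) 2)) : (Fin 3 →
          ℤ) → (EuclideanSpace ℂ (Fin 3))) k) hx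
      dsimp only at h
      rw [hTcoe, Submodule.coe_zero] at h
      rw [h]
      have hz : mFourierCoeff (0 : (UnitAddTorus (Fin 3)) → (EuclideanSpace ℂ (Fin 3))) k = 0 := by
        rw [show (0 : (UnitAddTorus (Fin 3)) → (EuclideanSpace ℂ (Fin 3))) = (0 : ℂ) • (0 : (UnitAddTorus (Fin 3)) →
            (EuclideanSpace ℂ (Fin 3))) by simp, mFourierCoeff_const_smul, zero_smul]
      rw [hz, lerayCoeff_zero_vec, neg_zero]
      rfl
    have hz0 : IsSmooth (0 : (UnitAddTorus (Fin 3)) → (EuclideanSpace ℂ (Fin 3))) := isSmooth_const (0 :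
        (EuclideanSpace ℂ (Fin 3)))
    have hz00 : mFourierCoeff (0 : (UnitAddTorus (Fin 3)) → (EuclideanSpace ℂ (Fin 3))) 0 = 0 := by
      rw [show (0 : (UnitAddTorus (Fin 3)) → (EuclideanSpace ℂ (Fin 3))) = (0 : ℂ) • (0 : (UnitAddTorus (Fin 3)) →
          (EuclideanSpace ℂ (Fin 3))) by simp, mFourierCoeff_const_smul, zero_smul]
    obtain ⟨w, hrel, hŵ⟩ := exists_linNSResolventRel_of_latticeEq hν hu₀ hdiv₀ hz0 hz00 (x : (lp (fun _ : Fin 3 →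
        ℤ => EuclideanSpace ℂ (Fin 3)) 2))
      (W_zero hW x) (W_trans hW x) hco
    obtain ⟨z, hwz⟩ := hker w hrel
    -- `cf x = z • 𝓕(∂_dir u₀)`, hence `= (Re z) • 𝓕(∂_dir u₀)` by conjugate symmetry
    have hcfx : ∀ k, (((fun mm : Fin 3 → ℤ => (((freqNormSq mm)⁻¹ : ℝ) : ℂ)) • (((x : (lp (fun _ : Fin 3 →
        ℤ => EuclideanSpace ℂ (Fin 3)) 2)) : (Fin 3 → ℤ) → (EuclideanSpace ℂ (Fin 3))) : (Fin 3 → ℤ) → EuclideanSpace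
        ℂ (Fin 3)))) k = z • mFourierCoeff (complexify ∘ v) k := by
      intro k
      rw [← hŵ, hwz, hgold, mFourierCoeff_const_smul]
    have hre := eq_re_smul_of_isConjSymm (isConjSymm_cf (W_conj hW x)) hVcs hcfx
    refine ⟨z.re, Subtype.ext (lp.ext ?_)⟩
    refine eq_of_cf_eq (W_zero hW x) (W_zero hW (z.re • g)) ?_
    rw [coeW_smul, cf_real_smul, hg]
    funext k
    rw [hre k, Pi.smul_apply]
  -- §7 range transfer: `T x ≠ −Fm d` (visibility)
  set FmL : Coeff S →L[ℝ] W := LinearMap.toContinuousLinearMap Fm with hFmL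
  have hFmL : ∀ e, FmL e = Fm e := fun e => rfl
  have hrangeT : ∀ x : W, T x ≠ (-FmL) d := by
    intro x hx
    have hco : ∀ k : (Fin 3 → ℤ), (((4 * Real.pi ^ 2 * ν : ℝ)) : ℂ) • ((x : (lp (fun _ : Fin 3 → ℤ => EuclideanSpace ℂ
        (Fin 3)) 2)) : (Fin 3 → ℤ) → (EuclideanSpace ℂ (Fin 3))) k +
        Torus.lerayCoeff k ((WithLp.toLp 2 (fun pp : Fin 3 => transportSym (fun jj mm => a mm jj) (fun mm => (((fun
            mm : Fin 3 → ℤ => (((freqNormSq mm)⁻¹ : ℝ) : ℂ)) • (((x : (lp (fun _ : Fin 3 → ℤ => EuclideanSpace ℂ (Fin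
            3)) 2)) : (Fin 3 → ℤ) → (EuclideanSpace ℂ (Fin 3))) : (Fin 3 → ℤ) → EuclideanSpace ℂ (Fin 3)))) mm pp)
            k) : EuclideanSpace ℂ (Fin 3)) + (WithLp.toLp 2 (fun pp : Fin 3 => transportSym (fun jj mm => (((fun mm :
            Fin 3 → ℤ => (((freqNormSq mm)⁻¹ : ℝ) : ℂ)) • (((x : (lp (fun _ : Fin 3 → ℤ => EuclideanSpace ℂ (Fin 3))
            2)) : (Fin 3 → ℤ) → (EuclideanSpace ℂ (Fin 3))) : (Fin 3 → ℤ) → EuclideanSpace ℂ (Fin 3)))) mm jj) (fun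
            mm => a mm pp) k) : EuclideanSpace ℂ (Fin 3))) =
        -Torus.lerayCoeff k (mFourierCoeff (complexify ∘ force S d) k) := by
      intro k
      have h := congrArg (fun z : W => (((z : W) : (lp (fun _ : Fin 3 → ℤ => EuclideanSpace ℂ (Fin 3)) 2)) : (Fin 3 →
          ℤ) → (EuclideanSpace ℂ (Fin 3))) k) hx
      dsimp only at h
      rw [hTcoe, neg_apply, Submodule.coe_neg, hFmL, lp.coeFn_neg, Pi.neg_apply, hFm] at h
      rw [h, lerayCoeff_forceCoeff]
    have hg0 : mFourierCoeff (complexify ∘ force S d) 0 = 0 :=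
      mFourierCoeff_complexify_zero_of_hasZeroMean (isSmooth_force' d) (hasZeroMean_force' d)
    obtain ⟨w, hrel, -⟩ := exists_linNSResolventRel_of_latticeEq hν hu₀ hdiv₀ (isSmooth_force' d).complexify_comp hg0
      (x : (lp (fun _ : Fin 3 → ℤ => EuclideanSpace ℂ (Fin 3)) 2)) (W_zero hW x) (W_trans hW x) hco
    have hcplx : cplx (force S d) = complexify ∘ force S d := by
      funext y; simp only [cplx, Function.comp_apply, realToComplex_eq_complexify]
    exact hvis w (by rw [hcplx]; exact hrel)
  -- §8 the isomorphism `J = cν·1` and compactness of `T − J = K`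
  set J : W ≃L[ℝ] W := ContinuousLinearEquiv.equivOfInverse (cν • ContinuousLinearMap.id ℝ W)
    (cν⁻¹ • ContinuousLinearMap.id ℝ W)
    (fun x => by
      change cν⁻¹ • (cν • x) = x
      rw [smul_smul, inv_mul_cancel₀ hcν0, one_smul])
    (fun x => by
      change cν • (cν⁻¹ • x) = x
      rw [smul_smul, mul_inv_cancel₀ hcν0, one_smul]) with hJ
  have hTJ : (T - (J : W →L[ℝ] W) : W →L[ℝ] W) = K := by
    ext w
    simp [hT, hJ]
  have hKTJ : IsCompactOperator (T - (J : W →L[ℝ] W) : W →L[ℝ] W) := by rw [hTJ]; exact hKc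
  -- §9 the base equation and the Malkin implicit function theorem
  have hGx₀ : G x₀ = Fm c := by
    refine Subtype.ext (lp.ext (funext fun k => ?_))
    rw [hGcoe, hFm, hcf]
    dsimp only
    rw [hx₀, ← heq₀ k, smul_eq_weight_smul_cf (by simp [hX₀, freqNormSq_zero]) k, hX₀]
    dsimp only
    rw [show ((fun mm : Fin 3 → ℤ => (((freqNormSq mm)⁻¹ : ℝ) : ℂ)) • ((fun k : (Fin 3 → ℤ) => ((freqNormSq k : ℝ) :
        ℂ) • a k) : (Fin 3 → ℤ) → EuclideanSpace ℂ (Fin 3))) = a from cf_weight_smul ha0]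
  have h00 : G x₀ + (-FmL) c = 0 := by
    rw [neg_apply, hFmL, hGx₀, add_neg_cancel]
  obtain ⟨φ, σ, υ, ℓ, r, hr, hσc, hυc, hσ, hℓ, hcont, hυ, hsol⟩ :=
    malkin_implicit G (-FmL) T J x₀ g c d hGcd hGd.hasFDerivAt h00 hKTJ hkerT hrangeT
  refine ⟨σ, ℓ, hσc, hσ, hℓ, fun δ hδ => ?_⟩
  -- §10 radii: continuity of `υ` at `c`
  set δ' : ℝ := min 1 (δ / (2 * (1 + 4 * Real.pi ^ 2))) with hδ'
  have hδ'0 : 0 < δ' := lt_min one_pos (by positivity)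
  have hδ'1 : δ' ≤ 1 := min_le_left _ _
  have hδ'2 : δ' ≤ δ / (2 * (1 + 4 * Real.pi ^ 2)) := min_le_right _ _
  obtain ⟨r₁, hr₁, hball₁⟩ := Metric.continuousAt_iff.1 hυ δ' hδ'0
  refine ⟨min r r₁, lt_min hr hr₁, hcont.mono (Metric.ball_subset_ball (min_le_left _ _)), fun c' hc' => ?_⟩
  have hc'r : c' ∈ Metric.ball c r := Metric.ball_subset_ball (min_le_left _ _) hc'
  have hc'r₁ : dist c' c < r₁ := lt_of_lt_of_le (Metric.mem_ball.1 hc') (min_le_right _ _)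
  set x : W := υ c' with hxdef
  have hGx : G x = Fm (c' - σ c' • d) := by
    have h := (hsol c' hc'r).1
    rw [neg_apply, hFmL, ← sub_eq_add_neg, sub_eq_zero] at h
    exact h
  -- §11 the perturbed solution is a classical steady state of the corrected force
  have hxeq : ∀ k : (Fin 3 → ℤ), (((4 * Real.pi ^ 2 * ν : ℝ)) : ℂ) • ((x : (lp (fun _ : Fin 3 → ℤ => EuclideanSpace ℂ
      (Fin 3)) 2)) : (Fin 3 → ℤ) → (EuclideanSpace ℂ (Fin 3))) k +
      Torus.lerayCoeff k ((WithLp.toLp 2 (fun pp : Fin 3 => transportSym (fun jj mm => (((fun mm : Fin 3 →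
          ℤ => (((freqNormSq mm)⁻¹ : ℝ) : ℂ)) • (((x : (lp (fun _ : Fin 3 → ℤ => EuclideanSpace ℂ (Fin 3)) 2)) : (Fin
          3 → ℤ) → (EuclideanSpace ℂ (Fin 3))) : (Fin 3 → ℤ) → EuclideanSpace ℂ (Fin 3)))) mm jj) (fun mm => (((fun
          mm : Fin 3 → ℤ => (((freqNormSq mm)⁻¹ : ℝ) : ℂ)) • (((x : (lp (fun _ : Fin 3 → ℤ => EuclideanSpace ℂ (Fin
          3)) 2)) : (Fin 3 → ℤ) → (EuclideanSpace ℂ (Fin 3))) : (Fin 3 → ℤ) → EuclideanSpace ℂ (Fin 3)))) mm pp) k) :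
          EuclideanSpace ℂ (Fin 3))) =
      mFourierCoeff (complexify ∘ force S (c' - σ c' • d)) k := by
    intro k
    have h := congrArg (fun z : W => (((z : W) : (lp (fun _ : Fin 3 → ℤ => EuclideanSpace ℂ (Fin 3)) 2)) : (Fin 3 → ℤ)
        → (EuclideanSpace ℂ (Fin 3))) k) hGx
    dsimp only at h
    rw [hGcoe, hFm] at h
    rw [← hcν]
    exact h
  obtain ⟨u', p', hst', hmean', hu', hû'⟩ := exists_steadyState_of_latticeEq hν (isSmooth_force' _)
    (isDivFree_force' _) (hasZeroMean_force' _) (x : (lp (fun _ : Fin 3 → ℤ => EuclideanSpace ℂ (Fin 3)) 2)) (W_zero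
        hW x) (W_trans hW x) (W_conj hW x) hxeq
  refine ⟨u', p', hst', hmean', ?_⟩
  -- §12 the `H¹` estimate
  set z : W := x - x₀ with hz
  have hzn : ‖z‖ < δ' := by
    rw [hz, ← dist_eq_norm]
    have := hball₁ hc'r₁
    rwa [hυc] at this
  have hvd : IsSmooth (fun y => u' y - u₀ y) := hu'.sub hu₀
  have hcoefv : mFourierCoeff (complexify ∘ fun y => u' y - u₀ y) = ((fun mm : Fin 3 → ℤ => (((freqNormSq mm)⁻¹ : ℝ) :
      ℂ)) • ((((z : W) : (lp (fun _ : Fin 3 → ℤ => EuclideanSpace ℂ (Fin 3)) 2)) : (Fin 3 → ℤ) → (EuclideanSpace ℂ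
      (Fin 3))) : (Fin 3 → ℤ) → EuclideanSpace ℂ (Fin 3))) := by
    have e : (complexify ∘ fun y => u' y - u₀ y : (UnitAddTorus (Fin 3)) → (EuclideanSpace ℂ (Fin 3))) = (complexify
        ∘ u') - (complexify ∘ u₀) := by
      funext y; simp
    rw [e, hz, coeW_sub]
    funext k
    rw [mFourierCoeff_sub hu'.complexify_comp.integrable hu₀.complexify_comp.integrable, hû', ← ha, ← hcf]
    simp only [Pi.smul_apply', Pi.sub_apply, smul_sub]
  have hH := h1_le_of_coeff hvd (z : (lp (fun _ : Fin 3 → ℤ => EuclideanSpace ℂ (Fin 3)) 2)) hcoefv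
  rw [norm_coeW] at hH
  change (∫ y, ‖u' y - u₀ y‖ ^ 2) + gradNormSq (fun y => u' y - u₀ y) < δ
  have hpi : (0 : ℝ) < 1 + 4 * Real.pi ^ 2 := by positivity
  have hzle : ‖z‖ ≤ δ' := hzn.le
  have hz2 : ‖z‖ ^ 2 ≤ δ' * δ' := by
    rw [sq]
    exact mul_le_mul hzle hzle (norm_nonneg z) ((norm_nonneg z).trans hzle)
  have hd : δ' * δ' ≤ δ' := mul_le_of_le_one_left hδ'0.le hδ'1
  calc (∫ y, ‖u' y - u₀ y‖ ^ 2) + gradNormSq (fun y => u' y - u₀ y) ≤ (1 + 4 * Real.pi ^ 2) * ‖z‖ ^ 2 := hH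
    _ ≤ (1 + 4 * Real.pi ^ 2) * δ' := mul_le_mul_of_nonneg_left (hz2.trans hd) hpi.le
    _ ≤ (1 + 4 * Real.pi ^ 2) * (δ / (2 * (1 + 4 * Real.pi ^ 2))) := mul_le_mul_of_nonneg_left hδ'2 hpi.le
    _ = δ / 2 := by field_simp
    _ < δ := half_lt_self hδ

end Bordered

/-- **Registered sub-goal `malkinBordered_partA`** (part file of `stub_malkinBordered`): the bordered steady
implicit function theorem `exists_bordered_correction` in Pi-form. [folklore] -/
theorem malkinBordered_partA : ∀ (S : Finset (Fin 3 → ℤ)) (c d : Coeff S) (ν : ℝ) (u₀ : UnitAddTorus (Fin 3) → EuclideanSpace ℝ (Fin 3)) (p₀ : UnitAddTorus (Fin 3) → ℝ) (dir : Fin 3 → ℤ), 0 < ν → Torus.IsSteadyNSState ν (force S c) u₀ p₀ → HasZeroMean u₀ → (∀ w, Torus.LinNSResolventRel ν u₀ 0 w 0 → ∃ z : ℂ, w = z • goldstone dir u₀) → (∀ w, ¬ Torus.LinNSResolventRel ν u₀ 0 w (cplx (force S d))) → ∃ (σ : Coeff S → ℝ) (ℓ : Coeff S →L[ℝ] ℝ),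 σ c = 0 ∧ HasFDerivAt σ ℓ c ∧ ℓ d = 1 ∧ ∀ δ : ℝ, 0 < δ → ∃ r : ℝ, 0 < r ∧ ContinuousOn σ (Metric.ball c r) ∧ ∀ c' ∈ Metric.ball c r, ∃ (u' : UnitAddTorus (Fin 3) → EuclideanSpace ℝ (Fin 3)) (p' : UnitAddTorus (Fin 3) → ℝ), Torus.IsSteadyNSState ν (force S (c' - σ c' • d)) u' p' ∧ HasZeroMean u' ∧ h1DistSq u' u₀ < δ :=
  fun _ _ _ _ _ _ _ hν hst h0 hker hvis => exists_bordered_correction hν hst h0 hker hvis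

end Summit.AnomalousDissipation.AnomalousDissipation.Theorems.RobustLoudUpgrade.MalkinBordered

end
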